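import Literature.AlgebraicGeometry.Resolution.FBlowup
import Literature.AlgebraicGeometry.Resolution.BlowupsGlue
import HarnessLib

/-!
# Uniqueness of F-blowups

Topic: `Literature/AlgebraicGeometry/Resolution`. PROVED: **two `e`-th F-blowups of the same
integral scheme are isomorphic over it** (`IsFBlowup.unique`), i.e. Yasuda's `FB_e(X) → X`
(Amer. J. Math. 134 (2012), Def. 2.2) is determined up to unique isomorphism by the local
description "blow-up of the Frobenius norm ideal on each affine open" (`IsFBlowup`,
`FBlowup.lean`; O. Villamayor U., J. Algebra 295 (2006), 3.4: "any representative defines the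
same morphism over `Spec(A)` … these morphisms patch").

* `IsFBlowup.isBlowup_of_isFrobeniusNormIdeal` — an F-blowup is a blowing up, over a nonempty
  affine open `U`, along the ideal sheaf of **every** Frobenius norm ideal of `Γ(X, U)`
  (isomorphic fractional ideals have the same blowing ups, `BlowupsScaling.lean`);
* `IsBlowup.hom_ext_of_range_subset'` — uniqueness of morphisms to a blowing up over an open,
  with the centre given on the open (variant of the tree's `hom_ext_of_range_subset`);
* `IsFBlowup.exists_hom` — morphisms `π₁⁻¹(U) → π₂⁻¹(U)` over the nonempty affine opens `U`
  commuting with the projections glue to `Y₁ → Y₂` over `X` (compatibility on overlaps by the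
  uniqueness half of the universal property over affine opens inside `U ∩ U'`);
* `IsFBlowup.unique` — the isomorphism `Y₁ ≅ Y₂` over `X`.

## Sources

* T. Yasuda, Amer. J. Math. 134 (2012) = arXiv:0706.2700, Def. 2.2, Prop. 2.5. [Yasuda2012]
* O. Villamayor U., J. Algebra 295 (2006), Thm. 3.3 (uniqueness in the universal property), 3.4.
  [Villamayoru2006]
-/

noncomputable section

open CategoryTheory CategoryTheory.Limits AlgebraicGeometry TopologicalSpace

namespace Literature.AlgebraicGeometry.Resolution

universe u

/-! ## Uniqueness of lifts over an open, centre given on the open -/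

/-- **Uniqueness of morphisms to a blowing up, local form**: if `π` restricted over the open
`U ⊆ X` is a blowing up of `U` along `K`, and `a, b : T → Y'` have the same composite
`a ≫ π = b ≫ π`, factoring as `q' ≫ U.ι` with `K` pulling back along `q'` to an effective Cartier
divisor, then `a = b`. [cite: StacksProject, Tag 0806] -/
theorem IsBlowup.hom_ext_of_range_subset' {Y' X : Scheme.{u}} {π : Y' ⟶ X} (U : X.Opens)
    {K : (U : Scheme.{u}).IdealSheafData} (hU : IsBlowup (π ∣_ U) K) {T : Scheme.{u}}
    {a b : T ⟶ Y'} (hab : a ≫ π = b ≫ π) (q' : T ⟶ U) (hq' : q' ≫ U.ι = a ≫ π)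
    (hcart : IsEffectiveCartier (K.comap q')) : a = b := by
  have hrange : Set.range (a ≫ π) ⊆ (U : Set X) := by
    rintro _ ⟨t, rfl⟩
    rw [← hq']
    exact (q' t).2
  have hra : Set.range a ⊆ Set.range (π ⁻¹ᵁ U).ι := by
    rintro _ ⟨t, rfl⟩
    rw [Scheme.Opens.range_ι]
    exact hrange ⟨t, rfl⟩
  have hrb : Set.range b ⊆ Set.range (π ⁻¹ᵁ U).ι := by
    rintro _ ⟨t, rfl⟩
    rw [Scheme.Opens.range_ι]
    change (b ≫ π) t ∈ U
    rw [← hab]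
    exact hrange ⟨t, rfl⟩
  let a' := IsOpenImmersion.lift (π ⁻¹ᵁ U).ι a hra
  let b' := IsOpenImmersion.lift (π ⁻¹ᵁ U).ι b hrb
  have ha' : a' ≫ (π ⁻¹ᵁ U).ι = a := IsOpenImmersion.lift_fac _ _ _
  have hb' : b' ≫ (π ⁻¹ᵁ U).ι = b := IsOpenImmersion.lift_fac _ _ _
  have ha'' : a' ≫ (π ∣_ U) = q' := by
    rw [← cancel_mono U.ι, Category.assoc, morphismRestrict_ι, ← Category.assoc, ha', hq']
  have hb'' : b' ≫ (π ∣_ U) = q' := by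
    rw [← cancel_mono U.ι, Category.assoc, morphismRestrict_ι, ← Category.assoc, hb', hq', hab]
  have hcart' : IsEffectiveCartier (K.comap (a' ≫ (π ∣_ U))) := by
    rw [ha'']
    exact hcart
  have : a' = b' := hU.hom_ext hcart' (by rw [ha'', hb''])
  rw [← ha', ← hb', this]

/-! ## Gluing morphisms between schemes blown up over the affine opens -/

section Glue

variable {Y₁ Y₂ X : Scheme.{u}} (π₁ : Y₁ ⟶ X) (π₂ : Y₂ ⟶ X) {ι : Type*} (V : ι → X.Opens)

/-- **Gluing morphisms of `X`-schemes along a cover of the base with local uniqueness**: let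
`V i` be an open cover of `X` closed under passing to small affine opens inside pairwise
intersections (`hbasis`), over each of which `π₂` is a blowing up along an ideal sheaf `K i`
that pulls back along `π₁` to an effective Cartier divisor; then morphisms
`m i : π₁⁻¹(V i) → π₂⁻¹(V i)` over `V i` glue to a morphism `Y₁ → Y₂` over `X`.
[cite: StacksProject, Tag 0806] -/
theorem exists_hom_of_local (hV : ⨆ i, V i = ⊤) (hbasis : ∀ (i j : ι) (x : X), x ∈ V i ⊓ V j →
      ∃ l, x ∈ V l ∧ V l ≤ V i ⊓ V j)
    (K : ∀ i, ((V i : X.Opens) : Scheme.{u}).IdealSheafData)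
    (h₂ : ∀ i, IsBlowup (π₂ ∣_ V i) (K i))
    (h₁ : ∀ i, IsEffectiveCartier ((K i).comap (π₁ ∣_ V i)))
    (m : ∀ i, (π₁ ⁻¹ᵁ V i : Scheme.{u}) ⟶ (π₂ ⁻¹ᵁ V i : Scheme.{u}))
    (hm : ∀ i, m i ≫ (π₂ ∣_ V i) = π₁ ∣_ V i) :
    ∃ G : Y₁ ⟶ Y₂, G ≫ π₂ = π₁ ∧ ∀ i, (π₁ ⁻¹ᵁ V i).ι ≫ G = m i ≫ (π₂ ⁻¹ᵁ V i).ι := by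
  let 𝒱 := Y₁.openCoverOfIsOpenCover (fun i => π₁ ⁻¹ᵁ V i) (.mk (π₁.iSup_preimage_eq_top hV))
  let g : ∀ i, (π₁ ⁻¹ᵁ V i : Scheme.{u}) ⟶ Y₂ := fun i => m i ≫ (π₂ ⁻¹ᵁ V i).ι
  have hgπ : ∀ i, g i ≫ π₂ = (π₁ ⁻¹ᵁ V i).ι ≫ π₁ := fun i => by
    change (m i ≫ (π₂ ⁻¹ᵁ V i).ι) ≫ π₂ = _
    rw [Category.assoc, ← morphismRestrict_ι, ← Category.assoc, hm i, morphismRestrict_ι]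
  -- compatibility on overlaps: local on the overlap, by uniqueness over small opens `V l`
  have hcompat : ∀ i j : ι,
      pullback.fst ((π₁ ⁻¹ᵁ V i).ι) ((π₁ ⁻¹ᵁ V j).ι) ≫ g i = pullback.snd _ _ ≫ g j := by
    intro i j
    let P := pullback ((π₁ ⁻¹ᵁ V i).ι) ((π₁ ⁻¹ᵁ V j).ι)
    -- the common composite `t : P → X`, with image in `V i ∩ V j`
    obtain ⟨t, ht⟩ : ∃ t : P ⟶ X,
        t = pullback.fst ((π₁ ⁻¹ᵁ V i).ι) ((π₁ ⁻¹ᵁ V j).ι) ≫ (π₁ ⁻¹ᵁ V i).ι ≫ π₁ := ⟨_, rfl⟩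
    have ht' : t = pullback.snd ((π₁ ⁻¹ᵁ V i).ι) ((π₁ ⁻¹ᵁ V j).ι) ≫ (π₁ ⁻¹ᵁ V j).ι ≫ π₁ := by
      rw [ht, ← Category.assoc, pullback.condition, Category.assoc]
    have hat : (pullback.fst ((π₁ ⁻¹ᵁ V i).ι) ((π₁ ⁻¹ᵁ V j).ι) ≫ g i) ≫ π₂ = t := by
      rw [Category.assoc, hgπ i, ht]
    have hbt : (pullback.snd ((π₁ ⁻¹ᵁ V i).ι) ((π₁ ⁻¹ᵁ V j).ι) ≫ g j) ≫ π₂ = t := by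
      rw [Category.assoc, hgπ j, ht']
    have hab : (pullback.fst ((π₁ ⁻¹ᵁ V i).ι) ((π₁ ⁻¹ᵁ V j).ι) ≫ g i) ≫ π₂ =
        (pullback.snd _ _ ≫ g j) ≫ π₂ := by rw [hat, hbt]
    have htmem : ∀ z : P, t z ∈ V i ⊓ V j := fun z => by
      constructor
      · rw [ht]
        exact (pullback.fst ((π₁ ⁻¹ᵁ V i).ι) ((π₁ ⁻¹ᵁ V j).ι) z).2
      · rw [ht']
        exact (pullback.snd ((π₁ ⁻¹ᵁ V i).ι) ((π₁ ⁻¹ᵁ V j).ι) z).2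
    -- equality is local on `P`: cover `P` by the `t⁻¹(V l)`, `V l ⊆ V i ∩ V j`
    let L := {l : ι // V l ≤ V i ⊓ V j}
    have hLcov : ⨆ l : L, t ⁻¹ᵁ V l.1 = ⊤ := by
      refine top_le_iff.mp fun z _ => ?_
      obtain ⟨l, hzl, hl⟩ := hbasis i j (t z) (htmem z)
      exact Opens.mem_iSup.mpr ⟨⟨l, hl⟩, hzl⟩
    let 𝒲 := P.openCoverOfIsOpenCover (fun l : L => t ⁻¹ᵁ V l.1) (.mk hLcov)
    refine Scheme.Cover.hom_ext 𝒲 _ _ fun l => ?_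
    change (t ⁻¹ᵁ V l.1).ι ≫ (pullback.fst _ _ ≫ g i) = (t ⁻¹ᵁ V l.1).ι ≫ (pullback.snd _ _ ≫ g j)
    -- compare by uniqueness for the blowing up over `V l`
    have halb : ((t ⁻¹ᵁ V l.1).ι ≫ (pullback.fst ((π₁ ⁻¹ᵁ V i).ι) ((π₁ ⁻¹ᵁ V j).ι) ≫ g i)) ≫ π₂ =
        ((t ⁻¹ᵁ V l.1).ι ≫ (pullback.snd _ _ ≫ g j)) ≫ π₂ := by
      have hab' := hab
      simp only [Category.assoc] at hab' ⊢
      exact congrArg (fun k => (t ⁻¹ᵁ V l.1).ι ≫ k) hab'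
    -- the factorisation `q' : t⁻¹(V l) → V l` of the common composite `(t⁻¹ V l).ι ≫ t`
    have hrq : Set.range ((t ⁻¹ᵁ V l.1).ι ≫ t) ⊆ Set.range (V l.1).ι := by
      rintro _ ⟨z, rfl⟩
      rw [Scheme.Opens.range_ι]
      exact z.2
    let q' := IsOpenImmersion.lift (V l.1).ι ((t ⁻¹ᵁ V l.1).ι ≫ t) hrq
    have hq' : q' ≫ (V l.1).ι =
        ((t ⁻¹ᵁ V l.1).ι ≫ (pullback.fst ((π₁ ⁻¹ᵁ V i).ι) ((π₁ ⁻¹ᵁ V j).ι) ≫ g i)) ≫ π₂ := by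
      rw [IsOpenImmersion.lift_fac, Category.assoc, hat]
    -- `q'` factors through `π₁ ∣_ V l` via an open immersion, so `K l` pulls back to a
    -- Cartier divisor along it
    have hrs : Set.range ((t ⁻¹ᵁ V l.1).ι ≫ pullback.fst ((π₁ ⁻¹ᵁ V i).ι) ((π₁ ⁻¹ᵁ V j).ι) ≫
        (π₁ ⁻¹ᵁ V i).ι) ⊆ Set.range (π₁ ⁻¹ᵁ V l.1).ι := by
      rintro _ ⟨z, rfl⟩
      rw [Scheme.Opens.range_ι]
      have hz : t z.1 ∈ V l.1 := z.2
      have hz' : (pullback.fst ((π₁ ⁻¹ᵁ V i).ι) ((π₁ ⁻¹ᵁ V j).ι) ≫ (π₁ ⁻¹ᵁ V i).ι ≫ π₁) z.1 ∈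
          V l.1 := by
        rw [← ht]
        exact hz
      simpa [Scheme.Hom.comp_apply] using hz'
    let s := IsOpenImmersion.lift (π₁ ⁻¹ᵁ V l.1).ι _ hrs
    have hs : s ≫ (π₁ ⁻¹ᵁ V l.1).ι = (t ⁻¹ᵁ V l.1).ι ≫ pullback.fst _ _ ≫ (π₁ ⁻¹ᵁ V i).ι :=
      IsOpenImmersion.lift_fac _ _ _
    haveI : IsOpenImmersion (s ≫ (π₁ ⁻¹ᵁ V l.1).ι) := by
      rw [hs]
      infer_instance
    haveI : IsOpenImmersion s := IsOpenImmersion.of_comp s (π₁ ⁻¹ᵁ V l.1).ι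
    have hsq : s ≫ (π₁ ∣_ V l.1) = q' := by
      rw [← cancel_mono (V l.1).ι, Category.assoc, morphismRestrict_ι, ← Category.assoc, hs,
        IsOpenImmersion.lift_fac, Category.assoc, Category.assoc, ht]
    have hcart : IsEffectiveCartier ((K l.1).comap q') := by
      rw [← hsq, Scheme.IdealSheafData.comap_comp]
      exact (h₁ l.1).comap_of_isOpenImmersion s
    exact IsBlowup.hom_ext_of_range_subset' (V l.1) (h₂ l.1) halb q' hq' hcart
  refine ⟨𝒱.glueMorphisms g hcompat, ?_, fun i => Scheme.Cover.ι_glueMorphisms 𝒱 g hcompat i⟩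
  apply Scheme.Cover.hom_ext 𝒱
  intro i
  change (π₁ ⁻¹ᵁ V i).ι ≫ 𝒱.glueMorphisms g hcompat ≫ π₂ = (π₁ ⁻¹ᵁ V i).ι ≫ π₁
  rw [← Category.assoc]
  have : (π₁ ⁻¹ᵁ V i).ι ≫ 𝒱.glueMorphisms g hcompat = g i :=
    Scheme.Cover.ι_glueMorphisms 𝒱 g hcompat i
  rw [this, hgπ i]

end Glue

/-! ## Uniqueness of F-blowups -/

namespace IsFBlowup

variable {p : ℕ} {e : ℕ} {Y₁ Y₂ X : Scheme.{u}} [IsIntegral X] [ExpChar X.functionField p]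
  {π₁ : Y₁ ⟶ X} {π₂ : Y₂ ⟶ X}

/-- **An F-blowup is a blowing up along every representative**: over a nonempty affine open
`U`, an `e`-th F-blowup is a blowing up of `Spec Γ(X, U)` along the ideal sheaf of any
Frobenius norm ideal `I ⊆ Γ(X, U)` (two representatives satisfy `f J = g I`, and isomorphic
fractional ideals have the same blowing ups). [cite: Villamayoru2006, 3.4] -/
theorem isBlowup_of_isFrobeniusNormIdeal {Y : Scheme.{u}} {π : Y ⟶ X} (h : IsFBlowup p e π)
    (U : X.affineOpens) [Nonempty (U : X.Opens)] {I : Ideal Γ(X, U)}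
    (hI : IsFrobeniusNormIdeal X.functionField p e I) :
    IsBlowup (π ∣_ (U : X.Opens) ≫ U.2.isoSpec.hom) (affineBlowup.idealSheaf I) := by
  obtain ⟨J, hJ, hb⟩ := h.exists_isBlowup U
  haveI : IsFractionRing Γ(X, U) X.functionField :=
    functionField_isFractionRing_of_isAffineOpen X U U.2
  obtain ⟨f, g, hf, hg, hfg⟩ := hJ.exists_mul_eq_mul hI
  exact (isBlowup_iff_of_span_singleton_mul_eq hJ.ne_bot hf hg hfg).mp hb

/-- The `↑U`-form of the local blow-up structure: over a nonempty affine open `U`, `π ∣_ U` is a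
blowing up of `U` along `Ĩ` moved to `U`, for every Frobenius norm ideal `I`. [folklore] -/
theorem isBlowup_restrict_of_isFrobeniusNormIdeal {Y : Scheme.{u}} {π : Y ⟶ X}
    (h : IsFBlowup p e π) (U : X.affineOpens) [Nonempty (U : X.Opens)] {I : Ideal Γ(X, U)}
    (hI : IsFrobeniusNormIdeal X.functionField p e I) :
    IsBlowup (π ∣_ (U : X.Opens)) ((affineBlowup.idealSheaf I).comap U.2.isoSpec.hom) := by
  have := (h.isBlowup_of_isFrobeniusNormIdeal U hI).comp_iso U.2.isoSpec.symm
  rwa [Iso.symm_hom, Iso.symm_inv, Category.assoc, Iso.hom_inv_id, Category.comp_id] at this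

/-- **Morphisms between F-blowups over `X` exist**: for two `e`-th F-blowups `π₁, π₂` of `X`
there is a morphism `Y₁ → Y₂` over `X` restricting over each nonempty affine open `U` to the
canonical isomorphism of the two blowing ups of the Frobenius norm ideal.
[cite: Villamayoru2006, Thm. 3.3 and 3.4] -/
theorem exists_hom (h₁ : IsFBlowup p e π₁) (h₂ : IsFBlowup p e π₂)
    (I : ∀ U : {U : X.affineOpens // Nonempty (U : X.Opens)}, Ideal Γ(X, U.1))
    (hI : ∀ U : {U : X.affineOpens // Nonempty (U : X.Opens)},
      haveI := U.2; IsFrobeniusNormIdeal X.functionField p e (I U))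
    (m : ∀ U : {U : X.affineOpens // Nonempty (U : X.Opens)},
      (π₁ ⁻¹ᵁ (U.1 : X.Opens) : Scheme.{u}) ⟶ (π₂ ⁻¹ᵁ (U.1 : X.Opens) : Scheme.{u}))
    (hm : ∀ U, m U ≫ (π₂ ∣_ (U.1 : X.Opens)) = π₁ ∣_ (U.1 : X.Opens)) :
    ∃ G : Y₁ ⟶ Y₂, G ≫ π₂ = π₁ ∧
      ∀ U, (π₁ ⁻¹ᵁ (U.1 : X.Opens)).ι ≫ G = m U ≫ (π₂ ⁻¹ᵁ (U.1 : X.Opens)).ι := by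
  refine exists_hom_of_local π₁ π₂
    (fun U : {U : X.affineOpens // Nonempty (U : X.Opens)} => (U.1 : X.Opens)) ?_ ?_
    (fun U => (affineBlowup.idealSheaf (I U)).comap U.1.2.isoSpec.hom) ?_ ?_ m hm
  · rw [eq_top_iff]
    rintro x -
    obtain ⟨U, hxU⟩ := exists_affineOpens_mem x
    exact Opens.mem_iSup.mpr ⟨⟨U, ⟨⟨x, hxU⟩⟩⟩, hxU⟩
  · intro U U' x hx
    obtain ⟨W, hW, hxW, hWle⟩ := exists_isAffineOpen_mem_and_subset (X := X) (x := x)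
      (U := (U.1 : X.Opens) ⊓ (U'.1 : X.Opens)) hx
    exact ⟨⟨⟨W, hW⟩, ⟨⟨x, hxW⟩⟩⟩, hxW, hWle⟩
  · intro U
    haveI := U.2
    exact h₂.isBlowup_restrict_of_isFrobeniusNormIdeal U.1 (hI U)
  · intro U
    haveI := U.2
    exact (h₁.isBlowup_restrict_of_isFrobeniusNormIdeal U.1 (hI U)).isEffectiveCartier

/-- **Uniqueness of F-blowups**: two `e`-th F-blowups `π₁ : Y₁ → X`, `π₂ : Y₂ → X` of the same
integral scheme are isomorphic over `X` (Yasuda's `FB_e(X) → X` is well defined; Villamayor,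
Thm. 3.3: the blow-up at a module is characterised by a universal property, and 3.4: the local
blow-ups patch uniquely). Over each nonempty affine open `U` both are blowing ups along the
ideal sheaf of a common Frobenius norm ideal, hence canonically isomorphic (`IsBlowup.unique`);
these isomorphisms and their inverses glue (`exists_hom`), and the two glued morphisms are
mutually inverse because they are so over each `U`.
[cite: Yasuda2012, Def. 2.2 and Prop. 2.5; Villamayoru2006, Thm. 3.3 and 3.4] -/
theorem unique (h₁ : IsFBlowup p e π₁) (h₂ : IsFBlowup p e π₂) :
    ∃ E : Y₁ ≅ Y₂, E.hom ≫ π₂ = π₁ ∧ E.inv ≫ π₁ = π₂ := by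
  classical
  -- common representatives and the local isomorphisms
  have hI' : ∀ U : {U : X.affineOpens // Nonempty (U : X.Opens)}, ∃ I : Ideal Γ(X, U.1),
      (haveI := U.2; IsFrobeniusNormIdeal X.functionField p e I) := fun U => by
    haveI := U.2
    obtain ⟨I, hI, -⟩ := h₁.exists_isBlowup U.1
    exact ⟨I, hI⟩
  choose I hI using hI'
  have hb₁ : ∀ U : {U : X.affineOpens // Nonempty (U : X.Opens)},
      IsBlowup (π₁ ∣_ (U.1 : X.Opens) ≫ U.1.2.isoSpec.hom) (affineBlowup.idealSheaf (I U)) :=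
    fun U => by haveI := U.2; exact h₁.isBlowup_of_isFrobeniusNormIdeal U.1 (hI U)
  have hb₂ : ∀ U : {U : X.affineOpens // Nonempty (U : X.Opens)},
      IsBlowup (π₂ ∣_ (U.1 : X.Opens) ≫ U.1.2.isoSpec.hom) (affineBlowup.idealSheaf (I U)) :=
    fun U => by haveI := U.2; exact h₂.isBlowup_of_isFrobeniusNormIdeal U.1 (hI U)
  have hE : ∀ U : {U : X.affineOpens // Nonempty (U : X.Opens)},
      ∃ E : (π₁ ⁻¹ᵁ (U.1 : X.Opens) : Scheme.{u}) ≅ (π₂ ⁻¹ᵁ (U.1 : X.Opens) : Scheme.{u}),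
        E.hom ≫ (π₂ ∣_ (U.1 : X.Opens) ≫ U.1.2.isoSpec.hom) =
          π₁ ∣_ (U.1 : X.Opens) ≫ U.1.2.isoSpec.hom ∧
        E.inv ≫ (π₁ ∣_ (U.1 : X.Opens) ≫ U.1.2.isoSpec.hom) =
          π₂ ∣_ (U.1 : X.Opens) ≫ U.1.2.isoSpec.hom := fun U => (hb₁ U).unique (hb₂ U)
  choose E hE₁ hE₂ using hE
  have hm₁ : ∀ U, (E U).hom ≫ (π₂ ∣_ (U.1 : X.Opens)) = π₁ ∣_ (U.1 : X.Opens) := fun U => by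
    rw [← cancel_mono U.1.2.isoSpec.hom, Category.assoc, hE₁ U]
  have hm₂ : ∀ U, (E U).inv ≫ (π₁ ∣_ (U.1 : X.Opens)) = π₂ ∣_ (U.1 : X.Opens) := fun U => by
    rw [← cancel_mono U.1.2.isoSpec.hom, Category.assoc, hE₂ U]
  -- glue in both directions
  obtain ⟨G, hG, hGU⟩ := exists_hom h₁ h₂ I hI (fun U => (E U).hom) hm₁
  obtain ⟨G', hG', hG'U⟩ := exists_hom h₂ h₁ I hI (fun U => (E U).inv) hm₂
  -- the covers of `Y₁`, `Y₂` by the charts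
  have hcov : ∀ {Y : Scheme.{u}} (π : Y ⟶ X),
      ⨆ U : {U : X.affineOpens // Nonempty (U : X.Opens)}, π ⁻¹ᵁ (U.1 : X.Opens) = ⊤ := by
    intro Y π
    refine π.iSup_preimage_eq_top ?_
    rw [eq_top_iff]
    rintro x -
    obtain ⟨U, hxU⟩ := exists_affineOpens_mem x
    exact Opens.mem_iSup.mpr ⟨⟨U, ⟨⟨x, hxU⟩⟩⟩, hxU⟩
  let 𝒱₁ := Y₁.openCoverOfIsOpenCover _ (.mk (hcov π₁))
  let 𝒱₂ := Y₂.openCoverOfIsOpenCover _ (.mk (hcov π₂))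
  refine ⟨⟨G, G', ?_, ?_⟩, hG, hG'⟩
  · apply Scheme.Cover.hom_ext 𝒱₁
    intro U
    change (π₁ ⁻¹ᵁ (U.1 : X.Opens)).ι ≫ G ≫ G' = (π₁ ⁻¹ᵁ (U.1 : X.Opens)).ι ≫ 𝟙 Y₁
    rw [← Category.assoc, hGU U, Category.assoc, hG'U U, Category.comp_id,
      (E U).hom_inv_id_assoc]
  · apply Scheme.Cover.hom_ext 𝒱₂
    intro U
    change (π₂ ⁻¹ᵁ (U.1 : X.Opens)).ι ≫ G' ≫ G = (π₂ ⁻¹ᵁ (U.1 : X.Opens)).ι ≫ 𝟙 Y₂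
    rw [← Category.assoc, hG'U U, Category.assoc, hGU U, Category.comp_id,
      (E U).inv_hom_id_assoc]

/-- Consequently **properness, integrality of the source and birationality of one `e`-th
F-blowup transfer to any other**; e.g. properness. [folklore] -/
theorem isProper_iff (h₁ : IsFBlowup p e π₁) (h₂ : IsFBlowup p e π₂) :
    IsProper π₁ ↔ IsProper π₂ := by
  obtain ⟨E, hE, hE'⟩ := h₁.unique h₂
  constructor
  · intro hp
    rw [← hE']
    infer_instance
  · intro hp
    rw [← hE]
    infer_instance

end IsFBlowup

end Literature.AlgebraicGeometry.Resolution

end
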